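import Summits.Parity.GeneralizedHardyLittlewood.Theorems.BeyondDiagonalBeatsQuarter.OffDiagPrincipalCoprime
import Summits.Parity.GeneralizedHardyLittlewood.Theorems.BeyondDiagonalBeatsQuarter.OffDiagCoreTallCount
import HarnessLib

/-!
# Route `PrimeLevelFamEdge`, crux K_B (stmt-Parity-20343), line `diagonal_kernel_split` rev 4, plan Ω,
# `OffDiagCoreTallCount` stage 2a (line lead 2026-08-28T17:02:08Z (2)): **the trivial size of the coprime-restricted
# principal object — `‖Σ'_{(s,h)=1} Φ̂(ξ₁, s/h + τ)‖ ≤ τ(|h|)·B·S₁` for a box of heights `< B` and a slice bound `S₁`,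
# hence `‖Σ'_{(s,h)=1} levelPrincipal G (Φ̂_q(ξ_q, s/h + τ_q)) n‖ ≤ φ(n)⁻¹·#G·τ(|h|)·B·S₁`, and over all moduli
# `h ≤ H` with `n = |h|`: `≤ #G·B·S₁·(1 + log H)⁴`**

prover-5's `OffDiagPrincipalCoprime.tsum_coprime_fourier2_intShift_eq_sum_Icc` evaluates the coprime-restricted
shifted-lattice sum of a box transform as a Möbius sum over the divisors `e ∣ |h|` of complete sublattice sample sums
`(|h|/e)·Σ_k e(−τ(|h|/e)k)·𝓕(t₁ ↦ Φ(t₁, (|h|/e)k))(ξ₁)` (Ramanujan coefficients `c_{|h|}(m)` by Kluyver); for TALL moduli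
the `e = 1` term is absent but the others sample the box. This file prices that object trivially (absolute values, no
cancellation in `h`), the input of the «a8P-TALL ≈ U × L» row the line lead wants as a kernel number:

* `card_filter_slice_ne_zero_le` — along a sublattice of step `d ≥ 1` at most `B/d` samples `k ≥ 1` meet a box of
  heights `(B₀, B)`, `B₀ ≥ 0` (`OffDiagPrincipalShort.lt_and_lt_of_fourier_slice_ne_zero`);
* `mul_norm_sum_phase_mul_slice_le` — `d·‖Σ_{k ≤ N} c_k·𝓕(Φ(·, dk))(ξ)‖ ≤ B·S₁` for `‖c_k‖ ≤ 1` and a slice bound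
  `‖𝓕(t₁ ↦ Φ(t₁, y))(ξ)‖ ≤ S₁`;
* **`norm_tsum_coprime_fourier2_intShift_le`** — `‖Σ'_{(s,h)=1} Φ̂(ξ₁, s/h + τ)‖ ≤ τ(|h|)·B·S₁` (every divisor
  contributes at most `B·S₁`: the `Σ_{m ∈ box} |c_{|h|}(m)| ≤ τ(|h|)·|box|` of the Ramanujan form);
* **`norm_tsum_coprime_levelPrincipal_le`** — after the density factor and the level sum
  (`tsum_coprime_levelPrincipal_eq`): `≤ φ(n)⁻¹·#G·τ(|h|)·B·S₁` for a slice bound uniform over the levels `q ∈ G`;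
* **`sum_norm_tsum_coprime_levelPrincipal_le`** — summed over moduli `h ∈ 𝓗 ⊆ [1, H]` with `n = h` (the reduced
  modulus `n₀ = |h₁|/gcd(ab,h₁)` of the K_B cell), using stage 1 `sum_card_divisors_mul_totient_inv_le`
  (`Σ_{n ≤ H} τ(n)/φ(n) ≤ (1 + log H)⁴`): `≤ #G·B·S₁·(1 + log H)⁴` — uniformly in the frequencies/shifts, which may
  depend on the modulus.
What is left for the `ms`-currency number (stage 2b) is the layer sum `Σ_{r,l,m,d,i} |c_l c_m|·(4πq̂/q)·…` with the slice
bound `S₁ = K₁·sup|Φ_i|` of the box weights — the pattern of prover-3's `OffDiagDualLedgerScales`, once the tall principal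
piece is a named part of `OffDiagCoreSplit.coreP` (worker-3 `OffDiagPrincipalSublattice`). Bounds only; no def; helper
toward `stub_offDiagBelowSlack_io` (`--supports stmt-Parity-20343`); closes nothing; standard axioms.
«The programme SEARCHES and TYPES; no claim about Landau–Siegel zeros, Theorems 1–2 of arXiv:2211.02515 or
a repaired Margin232 until a kernel theorem says so.»
-/

noncomputable section

open Real MeasureTheory Complex Finset
open scoped FourierTransform ArithmeticFunction.Moebius ContDiff

namespace Summit.Parity.GeneralizedHardyLittlewood.Theorems.BeyondDiagonalBeatsQuarter.OffDiag

open Literature.NumberTheory.Sieve.FriedlanderIwaniecPrimes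

/-! ### §1. One sublattice: at most `B/d` samples, each of size `≤ S₁` -/

section Sublattice

variable {Φ : ℝ → ℝ → ℂ}

/-- **At most `B/d` samples of a sublattice of step `d ≥ 1` meet the box.** If `Φ(t₁,t₂) ≠ 0 ⇒ B₀ < t₂ < B` with
`0 ≤ B₀`, `0 ≤ B`, then the `k ∈ [1, N]` with `𝓕(t₁ ↦ Φ(t₁, dk))(ξ) ≠ 0` satisfy `1 ≤ k < B/d`, so there are at most
`⌊B/d⌋ ≤ B/d` of them. [folklore] -/
theorem card_filter_slice_ne_zero_le {B₀ B : ℝ} (hB : 0 ≤ B)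
    (hsupp : ∀ t₁ t₂, Φ t₁ t₂ ≠ 0 → B₀ < t₂ ∧ t₂ < B) {d : ℕ} (hd : 0 < d) (N : ℕ) (ξ : ℝ) :
    (((Finset.Icc (1 : ℤ) N).filter (fun k : ℤ => 𝓕 (fun t₁ : ℝ ↦ Φ t₁ ((d : ℝ) * k)) ξ ≠ 0)).card : ℝ) ≤
      B / d := by
  classical
  have hdR : (0 : ℝ) < d := by exact_mod_cast hd
  have hBd : 0 ≤ B / d := div_nonneg hB hdR.le
  set T := (Finset.Icc (1 : ℤ) N).filter (fun k : ℤ => 𝓕 (fun t₁ : ℝ ↦ Φ t₁ ((d : ℝ) * k)) ξ ≠ 0) with hT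
  -- `T ⊆ [1, ⌊B/d⌋]`
  have hsub : T ⊆ Finset.Icc (1 : ℤ) ⌊B / d⌋ := by
    intro k hk
    have hk1 := (Finset.mem_Icc.1 (Finset.mem_filter.1 hk).1).1
    have hkB := (lt_and_lt_of_fourier_slice_ne_zero hsupp hd (Finset.mem_filter.1 hk).2).2
    exact Finset.mem_Icc.2 ⟨hk1, Int.le_floor.2 hkB.le⟩
  have h0 : 0 ≤ ⌊B / d⌋ := Int.floor_nonneg.2 hBd
  calc (T.card : ℝ) ≤ ((Finset.Icc (1 : ℤ) ⌊B / d⌋).card : ℝ) := by exact_mod_cast Finset.card_le_card hsub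
    _ = (((⌊B / d⌋ + 1 - 1).toNat : ℕ) : ℝ) := by rw [Int.card_Icc]
    _ = ((⌊B / d⌋ : ℤ) : ℝ) := by
        rw [add_sub_cancel_right]
        exact_mod_cast Int.toNat_of_nonneg h0
    _ ≤ B / d := Int.floor_le _

/-- **One sublattice, priced**: for a step `d ≥ 1`, coefficients `‖c_k‖ ≤ 1` and a slice bound
`‖𝓕(t₁ ↦ Φ(t₁, y))(ξ)‖ ≤ S₁` (all heights `y`), with the box support `(B₀, B)`, `B₀, B ≥ 0`:
`d·‖Σ_{k ∈ [1,N]} c_k·𝓕(t₁ ↦ Φ(t₁, dk))(ξ)‖ ≤ B·S₁`. [folklore] -/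
theorem mul_norm_sum_phase_mul_slice_le {B₀ B : ℝ} (hB : 0 ≤ B)
    (hsupp : ∀ t₁ t₂, Φ t₁ t₂ ≠ 0 → B₀ < t₂ ∧ t₂ < B) {d : ℕ} (hd : 0 < d) (N : ℕ) (ξ : ℝ) (c : ℤ → ℂ)
    (hc : ∀ k, ‖c k‖ ≤ 1) {S₁ : ℝ} (hS₁ : 0 ≤ S₁) (hslice : ∀ y : ℝ, ‖𝓕 (fun t₁ : ℝ ↦ Φ t₁ y) ξ‖ ≤ S₁) :
    (d : ℝ) * ‖∑ k ∈ Finset.Icc (1 : ℤ) N, c k * 𝓕 (fun t₁ : ℝ ↦ Φ t₁ ((d : ℝ) * k)) ξ‖ ≤ B * S₁ := by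
  classical
  have hdR : (0 : ℝ) < d := by exact_mod_cast hd
  set T := (Finset.Icc (1 : ℤ) N).filter (fun k : ℤ => 𝓕 (fun t₁ : ℝ ↦ Φ t₁ ((d : ℝ) * k)) ξ ≠ 0) with hT
  -- the sum lives on `T`, each term `≤ S₁`
  have h1 : ‖∑ k ∈ Finset.Icc (1 : ℤ) N, c k * 𝓕 (fun t₁ : ℝ ↦ Φ t₁ ((d : ℝ) * k)) ξ‖ ≤ (T.card : ℝ) * S₁ := by
    have hvan : ∑ k ∈ Finset.Icc (1 : ℤ) N, c k * 𝓕 (fun t₁ : ℝ ↦ Φ t₁ ((d : ℝ) * k)) ξ =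
        ∑ k ∈ T, c k * 𝓕 (fun t₁ : ℝ ↦ Φ t₁ ((d : ℝ) * k)) ξ := by
      rw [hT, Finset.sum_filter]
      refine Finset.sum_congr rfl fun k _ => ?_
      split_ifs with hk
      · rfl
      · rw [not_not.1 hk, mul_zero]
    rw [hvan]
    calc ‖∑ k ∈ T, c k * 𝓕 (fun t₁ : ℝ ↦ Φ t₁ ((d : ℝ) * k)) ξ‖
        ≤ ∑ k ∈ T, ‖c k * 𝓕 (fun t₁ : ℝ ↦ Φ t₁ ((d : ℝ) * k)) ξ‖ := norm_sum_le _ _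
      _ ≤ ∑ k ∈ T, S₁ := by
          refine Finset.sum_le_sum fun k _ => ?_
          rw [norm_mul]
          calc ‖c k‖ * ‖𝓕 (fun t₁ : ℝ ↦ Φ t₁ ((d : ℝ) * k)) ξ‖ ≤ 1 * S₁ :=
                mul_le_mul (hc k) (hslice _) (norm_nonneg _) zero_le_one
            _ = S₁ := one_mul _
      _ = (T.card : ℝ) * S₁ := by rw [Finset.sum_const, nsmul_eq_mul]
  have h2 : (T.card : ℝ) ≤ B / d := card_filter_slice_ne_zero_le hB hsupp hd N ξ
  calc (d : ℝ) * ‖∑ k ∈ Finset.Icc (1 : ℤ) N, c k * 𝓕 (fun t₁ : ℝ ↦ Φ t₁ ((d : ℝ) * k)) ξ‖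
      ≤ (d : ℝ) * ((T.card : ℝ) * S₁) := mul_le_mul_of_nonneg_left h1 hdR.le
    _ ≤ (d : ℝ) * (B / d * S₁) := mul_le_mul_of_nonneg_left (mul_le_mul_of_nonneg_right h2 hS₁) hdR.le
    _ = B * S₁ := by field_simp

end Sublattice

/-! ### §2. The coprime-restricted shifted-lattice sum and the principal cell -/

section Coprime

variable {Φ : ℝ → ℝ → ℂ}

/-- **Trivial size of the coprime-restricted shifted-lattice sum.** For `uncurry Φ` smooth of compact support with
heights in `(B₀, B)` (`B₀, B ≥ 0`), `h ≠ 0`, and a slice bound `‖𝓕(t₁ ↦ Φ(t₁, y))(ξ₁)‖ ≤ S₁`: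
`‖Σ'_{s ∈ ℤ, (s,h)=1} Φ̂(ξ₁, s/h + τ)‖ ≤ τ(|h|)·B·S₁` — in Ramanujan form `Σ_{m ∈ box} |c_{|h|}(m)|·S₁ ≤ τ(|h|)·|box|·S₁`.
[folklore] -/
theorem norm_tsum_coprime_fourier2_intShift_le (hΦ : ContDiff ℝ ∞ (Function.uncurry Φ))
    (hΦc : HasCompactSupport (Function.uncurry Φ)) {B₀ B : ℝ} (hB₀ : 0 ≤ B₀) (hB : 0 ≤ B)
    (hsupp : ∀ t₁ t₂, Φ t₁ t₂ ≠ 0 → B₀ < t₂ ∧ t₂ < B) {h : ℤ} (hh : h ≠ 0) (τ ξ₁ : ℝ) {S₁ : ℝ} (hS₁ : 0 ≤ S₁)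
    (hslice : ∀ y : ℝ, ‖𝓕 (fun t₁ : ℝ ↦ Φ t₁ y) ξ₁‖ ≤ S₁) :
    ‖∑' s : ℤ, (if IsCoprime s h then fourier2 Φ ξ₁ ((s : ℝ) / h + τ) else 0)‖ ≤
      (h.natAbs.divisors.card : ℝ) * B * S₁ := by
  have hN : B ≤ ((⌈B⌉₊ : ℕ) : ℝ) + 1 := by have := Nat.le_ceil B; linarith
  rw [tsum_coprime_fourier2_intShift_eq_sum_Icc hΦ hΦc hB₀ hsupp hh hN τ ξ₁]
  refine (norm_sum_le _ _).trans ?_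
  calc ∑ e ∈ h.natAbs.divisors, ‖(μ e : ℂ) * (((h.natAbs / e : ℕ) : ℂ) *
          ∑ k ∈ Finset.Icc (1 : ℤ) ⌈B⌉₊, (𝐞 (-(τ * ((h.natAbs / e : ℕ) * k))) : ℂ) *
            𝓕 (fun t₁ : ℝ ↦ Φ t₁ ((h.natAbs / e : ℕ) * k)) ξ₁)‖
      ≤ ∑ e ∈ h.natAbs.divisors, B * S₁ := by
        refine Finset.sum_le_sum fun e he => ?_
        have hstep : 0 < h.natAbs / e :=
          Nat.div_pos (Nat.le_of_dvd (Int.natAbs_pos.mpr hh) (Nat.dvd_of_mem_divisors he))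
            (Nat.pos_of_mem_divisors he)
        rw [norm_mul, norm_mul, Complex.norm_natCast]
        have hμ : ‖(μ e : ℂ)‖ ≤ 1 := by
          rw [Complex.norm_intCast]
          exact_mod_cast ArithmeticFunction.abs_moebius_le_one
        have hin := mul_norm_sum_phase_mul_slice_le hB hsupp hstep ⌈B⌉₊ ξ₁
          (fun k : ℤ => (((𝐞 (-(τ * ((h.natAbs / e : ℕ) * k))) : Circle) : ℂ)))
          (fun k => (Circle.norm_coe _).le) hS₁ hslice
        calc ‖(μ e : ℂ)‖ * (((h.natAbs / e : ℕ) : ℝ) *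
              ‖∑ k ∈ Finset.Icc (1 : ℤ) ⌈B⌉₊, (𝐞 (-(τ * ((h.natAbs / e : ℕ) * k))) : ℂ) *
                𝓕 (fun t₁ : ℝ ↦ Φ t₁ ((h.natAbs / e : ℕ) * k)) ξ₁‖)
            ≤ 1 * (B * S₁) := mul_le_mul hμ hin (by positivity) zero_le_one
          _ = B * S₁ := one_mul _
    _ = (h.natAbs.divisors.card : ℝ) * B * S₁ := by rw [Finset.sum_const, nsmul_eq_mul, mul_assoc]

open Classical in
/-- **Trivial size of the principal cell.** For a finite set of levels `G`, box weights `Φ_q` (smooth, compact support,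
heights in `(B₀, B)`, `B₀, B ≥ 0`), `h ≠ 0`, frequencies `ξ₁ q`, shifts `τ q`, a bookkeeping modulus `n` and a slice bound
`‖𝓕(t₁ ↦ Φ_q(t₁, y))(ξ₁ q)‖ ≤ S₁` uniform in `q ∈ G` and `y`:
`‖Σ'_{(s,h)=1} levelPrincipal G (q ↦ Φ̂_q(ξ₁ q, s/h + τ q)) n‖ ≤ φ(n)⁻¹·#G·τ(|h|)·B·S₁`. [folklore] -/
theorem norm_tsum_coprime_levelPrincipal_le (G : Finset ℕ) (Φ : ℕ → ℝ → ℝ → ℂ)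
    (hΦ : ∀ q ∈ G, ContDiff ℝ ∞ (Function.uncurry (Φ q)))
    (hΦc : ∀ q ∈ G, HasCompactSupport (Function.uncurry (Φ q))) {B₀ B : ℝ} (hB₀ : 0 ≤ B₀) (hB : 0 ≤ B)
    (hsupp : ∀ q ∈ G, ∀ t₁ t₂, Φ q t₁ t₂ ≠ 0 → B₀ < t₂ ∧ t₂ < B)
    {h : ℤ} (hh : h ≠ 0) (ξ₁ τ : ℕ → ℝ) (n : ℕ) {S₁ : ℝ} (hS₁ : 0 ≤ S₁)
    (hslice : ∀ q ∈ G, ∀ y : ℝ, ‖𝓕 (fun t₁ : ℝ ↦ Φ q t₁ y) (ξ₁ q)‖ ≤ S₁) :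
    ‖∑' s : ℤ, (if IsCoprime s h then
        levelPrincipal G (fun q ↦ fourier2 (Φ q) (ξ₁ q) ((s : ℝ) / h + τ q)) n else 0)‖ ≤
      ((Nat.totient n : ℝ))⁻¹ * G.card * ((h.natAbs.divisors.card : ℝ) * B * S₁) := by
  rw [tsum_coprime_levelPrincipal_eq G Φ hΦ hΦc hh ξ₁ τ n, norm_mul, norm_inv, Complex.norm_natCast, mul_assoc]
  refine mul_le_mul_of_nonneg_left ?_ (inv_nonneg.2 (Nat.cast_nonneg (α := ℝ) _))
  have hG' : ∀ q ∈ G.filter (fun q : ℕ ↦ IsUnit ((q : ℕ) : ZMod n)), q ∈ G :=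
    fun q hq ↦ (Finset.mem_filter.mp hq).1
  refine (norm_sum_le _ _).trans ?_
  calc ∑ q ∈ G.filter (fun q : ℕ ↦ IsUnit ((q : ℕ) : ZMod n)),
        ‖∑ e ∈ h.natAbs.divisors, (μ e : ℂ) * (((h.natAbs / e : ℕ) : ℂ) *
          ∑' k : ℤ, (𝐞 (-(τ q * ((h.natAbs / e : ℕ) * k))) : ℂ) *
            𝓕 (fun t₁ : ℝ ↦ Φ q t₁ ((h.natAbs / e : ℕ) * k)) (ξ₁ q))‖
      ≤ ∑ q ∈ G.filter (fun q : ℕ ↦ IsUnit ((q : ℕ) : ZMod n)), (h.natAbs.divisors.card : ℝ) * B * S₁ := by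
        refine Finset.sum_le_sum fun q hq => ?_
        rw [← tsum_coprime_fourier2_intShift_eq (hΦ q (hG' q hq)) (hΦc q (hG' q hq)) hh (τ q) (ξ₁ q)]
        exact norm_tsum_coprime_fourier2_intShift_le (hΦ q (hG' q hq)) (hΦc q (hG' q hq)) hB₀ hB
          (hsupp q (hG' q hq)) hh (τ q) (ξ₁ q) hS₁ (hslice q (hG' q hq))
    _ = ((G.filter (fun q : ℕ ↦ IsUnit ((q : ℕ) : ZMod n))).card : ℝ) *
          ((h.natAbs.divisors.card : ℝ) * B * S₁) := by rw [Finset.sum_const, nsmul_eq_mul]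
    _ ≤ (G.card : ℝ) * ((h.natAbs.divisors.card : ℝ) * B * S₁) := by
        have hc : ((G.filter (fun q : ℕ ↦ IsUnit ((q : ℕ) : ZMod n))).card : ℝ) ≤ G.card := by
          exact_mod_cast Finset.card_filter_le _ _
        exact mul_le_mul_of_nonneg_right hc (by positivity)

/-- **Summed over the moduli** (`n = h`, the reduced modulus of the cell): for moduli `h ∈ 𝓗 ⊆ [1, H]` (e.g. the TALL
range `[B, H₁]`), modulus-dependent frequencies `ξ₁ h q`, shifts `τ h q` and box weights as above with a uniform slice
bound `S₁`:
`Σ_{h ∈ 𝓗} ‖Σ'_{(s,h)=1} levelPrincipal G (q ↦ Φ̂_q(ξ₁ h q, s/h + τ h q)) h‖ ≤ #G·B·S₁·(1 + log H)⁴`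
(stage 1 `sum_card_divisors_mul_totient_inv_le`: `Σ_{h ≤ H} τ(h)/φ(h) ≤ (1 + log H)⁴`) — the «a8P-TALL» mass per cell
before the layer sum, with `log(H₁/2K₂)·τ`-factors priced as `(1 + log H₁)⁴`. [folklore] -/
theorem sum_norm_tsum_coprime_levelPrincipal_le (G : Finset ℕ) (Φ : ℕ → ℝ → ℝ → ℂ)
    (hΦ : ∀ q ∈ G, ContDiff ℝ ∞ (Function.uncurry (Φ q)))
    (hΦc : ∀ q ∈ G, HasCompactSupport (Function.uncurry (Φ q))) {B₀ B : ℝ} (hB₀ : 0 ≤ B₀) (hB : 0 ≤ B)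
    (hsupp : ∀ q ∈ G, ∀ t₁ t₂, Φ q t₁ t₂ ≠ 0 → B₀ < t₂ ∧ t₂ < B)
    {H : ℕ} {𝓗 : Finset ℕ} (h𝓗 : 𝓗 ⊆ Finset.Icc 1 H) (ξ₁ τ : ℕ → ℕ → ℝ) {S₁ : ℝ} (hS₁ : 0 ≤ S₁)
    (hslice : ∀ h ∈ 𝓗, ∀ q ∈ G, ∀ y : ℝ, ‖𝓕 (fun t₁ : ℝ ↦ Φ q t₁ y) (ξ₁ h q)‖ ≤ S₁) :
    ∑ h ∈ 𝓗, ‖∑' s : ℤ, (if IsCoprime s (h : ℤ) then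
        levelPrincipal G (fun q ↦ fourier2 (Φ q) (ξ₁ h q) ((s : ℝ) / (h : ℤ) + τ h q)) h else 0)‖ ≤
      (G.card : ℝ) * B * S₁ * (1 + Real.log H) ^ 4 := by
  have hper : ∀ h ∈ 𝓗, ‖∑' s : ℤ, (if IsCoprime s (h : ℤ) then
      levelPrincipal G (fun q ↦ fourier2 (Φ q) (ξ₁ h q) ((s : ℝ) / (h : ℤ) + τ h q)) h else 0)‖ ≤
        (G.card : ℝ) * B * S₁ * ((h.divisors.card : ℝ) * ((Nat.totient h : ℝ))⁻¹) := by
    intro h hh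
    have h1 : 1 ≤ h := (Finset.mem_Icc.1 (h𝓗 hh)).1
    have hh0 : (h : ℤ) ≠ 0 := by exact_mod_cast (show h ≠ 0 by omega)
    have key := norm_tsum_coprime_levelPrincipal_le G Φ hΦ hΦc hB₀ hB hsupp hh0 (ξ₁ h) (τ h) h hS₁ (hslice h hh)
    rw [Int.natAbs_natCast] at key
    refine key.trans (le_of_eq ?_)
    ring
  calc ∑ h ∈ 𝓗, ‖∑' s : ℤ, (if IsCoprime s (h : ℤ) then
        levelPrincipal G (fun q ↦ fourier2 (Φ q) (ξ₁ h q) ((s : ℝ) / (h : ℤ) + τ h q)) h else 0)‖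
      ≤ ∑ h ∈ 𝓗, (G.card : ℝ) * B * S₁ * ((h.divisors.card : ℝ) * ((Nat.totient h : ℝ))⁻¹) :=
        Finset.sum_le_sum hper
    _ = (G.card : ℝ) * B * S₁ * ∑ h ∈ 𝓗, (h.divisors.card : ℝ) * ((Nat.totient h : ℝ))⁻¹ := by
        rw [Finset.mul_sum]
    _ ≤ (G.card : ℝ) * B * S₁ * ∑ h ∈ Finset.Icc 1 H, (h.divisors.card : ℝ) * ((Nat.totient h : ℝ))⁻¹ := by
        refine mul_le_mul_of_nonneg_left (Finset.sum_le_sum_of_subset_of_nonneg h𝓗 fun h _ _ => ?_)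
          (by positivity)
        exact mul_nonneg (Nat.cast_nonneg _) (inv_nonneg.2 (Nat.cast_nonneg _))
    _ ≤ (G.card : ℝ) * B * S₁ * (1 + Real.log H) ^ 4 :=
        mul_le_mul_of_nonneg_left (sum_card_divisors_mul_totient_inv_le H) (by positivity)

end Coprime


end Summit.Parity.GeneralizedHardyLittlewood.Theorems.BeyondDiagonalBeatsQuarter.OffDiag
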